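import Summits.HodgeConjecture.HodgeConjecture.Theses.LinearSystemTorelli
import Literature.AlgebraicGeometry.HodgeTheory.ComplexGysinCorrespondence
import Literature.AlgebraicGeometry.HodgeTheory.ComplexGysinRational
import Literature.AlgebraicGeometry.HodgeTheory.RationalClassesRingChange
import Literature.AlgebraicGeometry.HodgeTheory.GysinHodgeClassLiftProofs
import Literature.AlgebraicGeometry.HodgeTheory.HardLefschetzThreefold
import Literature.AlgebraicGeometry.Motives.ComplexPointsOrientation
import Literature.AlgebraicGeometry.HodgeTheory.GysinKernelProofs

/-!
# Crux `TranscendentalOrSupported` (stmt-HodgeConjecture-10853), line `Sketch_chow_shadow` — stub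
# `stub_corrActionRat`: a rational self-correspondence acts on rational classes rationally, up to
# ONE non-zero scalar

Helper file for the line skeleton `Sketch_chow_shadow` (cohomological transcendental decomposition of
the diagonal) of the crux `TranscendentalOrSupported` of route `LinearSystemTorelli` (GHC(2p,
coniveau 1) in Grothendieck's sub-Hodge form), registered stub `stub_corrActionRat`. Notation: `X`
smooth projective of dimension `n`, `μ` an orientation family, `γ ∈ H^{2n}((X ⊗ X)(ℂ); ℂ)`,
`γ^* = corrAction μ hX hX hab γ : Hᵏ(X(ℂ); ℂ) → Hᵏ(X(ℂ); ℂ)`, `c ↦ pr_{1*}(pr_2^* c ∪ γ)`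
(`corrAction_apply`; `pr_{1*} = complexGysin μ … (fst X X)` the Gysin morphism of the first
projection, `PD⁻¹ ∘ pr_1(ℂ)_* ∘ PD` in degrees `≤ 2 dim (X ⊗ X)` and `0` beyond; `pr_2^*` the
pull-back along the second projection), and `ι = singularCohomology.ringChange (ℚ ↪ ℂ)` the change of
coefficients, whose image is exactly the set of rational classes
(`isRationalClass_iff_exists_ringChange`).

CLAIM (`stub_corrActionRat`). For `γ` RATIONAL there is ONE scalar `u ≠ 0` such that for every
rational `c ∈ Hᵏ(X(ℂ); ℂ)`, `γ^* c = u • c'` with `c'` rational.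

PROOF (Voisin I §7.3.2: the action of a rational correspondence is defined on RATIONAL cohomology,
the Gysin morphism being induced by `pr_1(ℂ)_*` on rational homology through Poincaré duality;
Fulton, Young Tableaux, App. B §B.1 (5)). `pr_2^* c` is rational (`IsRationalClass.pullback`),
`pr_2^* c ∪ γ` is rational (`IsRationalClass.cup`, the Alexander–Whitney product of `ℚ`-valued
cocycles). In degrees `k + 2n > 2 (n + n)`, `pr_{1*} = 0` (`complexGysin_of_lt`): take `u = 1`,
`c' = 0`. Otherwise choose `ℚ`-orientations `ν_{X ⊗ X}`, `ν_X` (`Motives.ComplexPoints.isOrientableOver`),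
`ν_X` with Poincaré duality (`exists_ratOrientation_hasPoincareDuality`); then for ONE scalar `u ≠ 0`,
`pr_{1*} (ι y) = u • ι (pr_{1!} y)` for all `y ∈ H^{k+2n}((X ⊗ X)(ℂ); ℚ)`, `pr_{1!}` the rational Gysin
homomorphism (`complexGysin_ringChange_eq_smul_gysinMap`, with Poincaré duality for `μ`,
`OrientationFamily.hasPoincareDuality`). Writing the rational class `pr_2^* c ∪ γ = ι y`
(`IsRationalClass.exists_ringChange_eq`), `γ^* c = u • ι (pr_{1!} y)` with `ι (pr_{1!} y)` rational
(`isRationalClass_ringChange`).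

Pure tree theorem; no named fact is taken as a hypothesis and none is introduced.

References: C. Voisin, *Hodge Theory and Complex Algebraic Geometry I* (CUP 2002), §7.1.1, §7.3.2;
C. Voisin, *Hodge Theory and Complex Algebraic Geometry II* (CUP 2003), proof of Thm. 10.17, (10.7);
W. Fulton, *Young Tableaux* (CUP 1997), App. B §B.1 (5); A. Hatcher, *Algebraic Topology*
(CUP 2002), §3.1 p. 198, §3.2 p. 206, §3.3 Thm. 3.30.
-/

-- `Summit.HodgeConjecture.HodgeConjecture.Theorems` is the mandated namespace (single-conjunct summit:
-- Sub = Summit), which `linter.dupNamespace` flags on every declaration; the lakefile turns the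
-- linter off tree-wide (weak option), restated here so stand-alone elaboration is warning-free too.
set_option linter.dupNamespace false

noncomputable section

namespace Summit.HodgeConjecture.HodgeConjecture.Theorems

open CategoryTheory MonoidalCategory CartesianMonoidalCategory
open Literature.AlgebraicGeometry.Motives Literature.AlgebraicGeometry.HodgeTheory
open Literature.AlgebraicTopology.SingularHomology

/-! ### The stub -/

/-- **STUB `stub_corrActionRat` (a rational self-correspondence acts on rational classes rationally,
up to ONE non-zero scalar) of the crux `TranscendentalOrSupported`, line `Sketch_chow_shadow`.** For
`X` smooth projective of dimension `n`, an orientation family `μ` and `γ ∈ H^{2n}((X ⊗ X)(ℂ); ℂ)`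
rational, there is `u ≠ 0` with `γ^* c = pr_{1*}(pr_2^* c ∪ γ) ∈ u • {rational classes}` for every
rational `c ∈ Hᵏ(X(ℂ); ℂ)`: `pr_2^* c` is rational (`IsRationalClass.pullback`), `pr_2^* c ∪ γ` is
rational (`IsRationalClass.cup`), and on rational classes `pr_{1*} = complexGysin μ … (fst X X)` is
the rational Gysin homomorphism up to one non-zero scalar (`complexGysin_ringChange_eq_smul_gysinMap`,
with `exists_ratOrientation_hasPoincareDuality`, `IsRationalClass.exists_ringChange_eq`,
`isRationalClass_ringChange`); in degrees beyond the top, `pr_{1*} = 0` (`complexGysin_of_lt`).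
[cite: VoisinHodgeI2002, §7.3.2] [cite: VoisinHodgeII2003, proof of Thm. 10.17 (10.7)]
[cite: FultonYoungTableaux1997, Appendix B §B.1 (5)] -/
theorem stub_corrActionRat :
    ∀ (μ : OrientationFamily) ⦃n : ℕ⦄ ⦃X : SchemeOver ℂ⦄ (hX : IsSmoothProjective n X)
    ⦃k : ℕ⦄ (hab : k + 2 * n = k + 2 * n) ⦃γ : complexBetti (X ⊗ X) (2 * n)⦄, IsRationalClass γ →
    ∃ u : ℂ, u ≠ 0 ∧ ∀ c : complexBetti X k, IsRationalClass c →
      ∃ c' : complexBetti X k, IsRationalClass c' ∧ corrAction μ hX hX hab γ c = u • c' := by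
  intro μ n X hX k hab γ hγ
  -- `X ⊗ X` is smooth projective of dimension `n + n`
  have hXX : IsSmoothProjective (n + n) (X ⊗ X) := IsSmoothProjective.tensor_holds hX hX
  by_cases h : 2 * (n + n) < k + 2 * n
  · -- beyond the top degree of `(X ⊗ X)(ℂ)` the Gysin morphism `pr_{1*}` is `0`
    refine ⟨1, one_ne_zero, fun c _ ↦ ⟨0, IsRationalClass.zero, ?_⟩⟩
    rw [corrAction_apply, complexGysin_of_lt hXX hX (fst X X) (corrAction_degree n hab) h,
      LinearMap.zero_apply, smul_zero]
  · -- `ℚ`-orientations, `ν_X` with Poincaré duality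
    obtain ⟨νY⟩ := Literature.AlgebraicGeometry.Motives.ComplexPoints.isOrientableOver ℚ hXX
    obtain ⟨νX, hνX⟩ := exists_ratOrientation_hasPoincareDuality hX
    -- `pr_{1*} (ι y) = u • ι (pr_{1!} y)` with ONE scalar `u ≠ 0`
    obtain ⟨u, hu0, hu⟩ := complexGysin_ringChange_eq_smul_gysinMap (μ := μ) μ.hasPoincareDuality
      hXX hX (fst X X) (a := k + 2 * n) (b := k) (q := 2 * (n + n) - (k + 2 * n)) (by omega)
      (by omega) νY νX hνX
    refine ⟨u, hu0, fun c hc ↦ ?_⟩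
    -- `pr_2^* c ∪ γ` is rational, `= ι y`
    have hcup : IsRationalClass
        (cupProduct (rfl : k + 2 * n = k + 2 * n) (complexBetti.map (snd X X) k c) γ) :=
      (hc.pullback _).cup _ hγ
    obtain ⟨y, hy⟩ := hcup.exists_ringChange_eq
    refine ⟨singularCohomology.ringChange (algebraMap ℚ ℂ) (ComplexPoints X) k
      (gysinMap νY νX (AlgPoints.mapContinuous (L := ℂ) (fst X X))
        (q := 2 * (n + n) - (k + 2 * n)) (by omega) (by omega) y),
      isRationalClass_ringChange _, ?_⟩
    rw [corrAction_apply, ← hy, hu y]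

end Summit.HodgeConjecture.HodgeConjecture.Theorems

end
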